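import Mathlib
import Summits.ValiantsHypothesis.ValiantsHypothesis.Theorems.RigidityForcesSymmetryRankRigidMinimalReprLaplaceFivePairCoreBasics

/-!
# `LaplaceOptimalFive`: the pair profile «triangle + double edge» (`K₃ ⊔ 2K₂`, Laplace weight 60) is impossible
# (crux `RankRigidMinimalRepr`, stmt-ValiantsHypothesis-18034; frontier rung `LaplaceOptimalFive`, stmt-24813)

Toward the rung `72 ≤ weight` of the frontier item `LaplaceOptimal 5` (stmt-24813; the tree has `60 ≤ weight`,
`LaplaceRestrict.laplace_five_weight_ge_sixty`).  By the five slot-contraction inequalities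
(`LaplaceContract.laplace_five_slot_contraction`) a decomposition of the `5 × 5` permutation pattern `P₅` of weight `< 72`
is PAIR-ONLY with a `2`-regular multigraph of five pair terms: the `5`-cycle, or a triangle plus a doubled edge.  This file
kills the second shape:

  `P₅(v) ≠ u₀₁(v₀,v₁)·w₀₁(v₂,v₃,v₄) + u₀₂(v₀,v₂)·w₀₂(v₁,v₃,v₄) + u₁₂(v₁,v₂)·w₁₂(v₀,v₃,v₄) + u_A(v₃,v₄)·w_A(v₀,v₁,v₂) + u_B(v₃,v₄)·w_B(v₀,v₁,v₂)`

(`triangle_digon`).  Proof — pure linear algebra, no genericity: summing over `v₀` turns the identity into one for the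
rectangular pattern `P₄,₅(a,b,c,d) = [a,b,c,d pairwise distinct]` in which the two triangle edges at slot `0` have become
SLICES `f(a)·w₀₁(b,c,d)`, `g(b)·w₀₂(a,c,d)` and the three other terms are PARALLEL to the split `{1,2}|{3,4}`
(`contract_slot0`).  Hence the `{1,2}|{3,4}` flattening `Φ(T)(c,d) = Σ_{a,b} T_{ab} P₄,₅(a,b,c,d)` maps the space
`M = {T : fᵀT = 0, Tg = 0}` (dimension `≥ 15`, and `≥ 20` if `f = 0`) into the span of three fixed matrices.  But
`ker Φ ⊆ {T : T + Tᵀ diagonal}` (`LaplaceFivePairCore.flattening_kernel`) has dimension `≤ 15` and meets `{T : fᵀT = 0}`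
in dimension `≤ 11` when `f ≠ 0` (`T ↦ fᵀT` maps the antisymmetric matrices onto `f^⊥`) — so `15 ≤ 3 + 11` resp.
`20 ≤ 3 + 15`, contradiction (`core`).

HONEST FRAMING: an exact partial result (one of the two weight-60 pair profiles) toward the frontier rung
`LaplaceOptimalFive` (stmt-24813), which stays OPEN; nothing here bears on the crux or on `VP ≠ VNP`, which is NOT proved.
-/

set_option autoImplicit false

-- the mandated summit-side namespace repeats a component by design (single-problem summit)
set_option linter.dupNamespace false

namespace Summit.ValiantsHypothesis.ValiantsHypothesis.Theorems.RigidityForcesSymmetryRankRigidMinimalRepr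

namespace LaplaceFivePairCore

open Finset Module

/-! ### §1 The contracted identity -/

/-- **Contraction at slot `0`.**  Summing the `K₃ ⊔ 2K₂` identity over `v₀` gives, for the rectangular pattern `P₄,₅`,
two slices at slots `1, 2` with the FIXED cofactors `w₀₁, w₀₂` and three pair terms parallel to `{1,2}|{3,4}`. -/
theorem contract_slot0 (u01 u02 u12 uA uB : Fin 5 → Fin 5 → ℂ) (w01 w02 w12 wA wB : Fin 5 → Fin 5 → Fin 5 → ℂ)
    (hsum : ∀ v : Fin 5 → Fin 5, (if Function.Injective v then (1 : ℂ) else 0) =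
      u01 (v 0) (v 1) * w01 (v 2) (v 3) (v 4) + u02 (v 0) (v 2) * w02 (v 1) (v 3) (v 4) +
      u12 (v 1) (v 2) * w12 (v 0) (v 3) (v 4) + uA (v 3) (v 4) * wA (v 0) (v 1) (v 2) + uB (v 3) (v 4) * wB (v 0) (v 1) (v 2))
    (a b c d : Fin 5) :
    (if (a ≠ b ∧ a ≠ c ∧ a ≠ d ∧ b ≠ c ∧ b ≠ d ∧ c ≠ d) then (1 : ℂ) else 0) =
      (∑ e, u01 e a) * w01 b c d + (∑ e, u02 e b) * w02 a c d + u12 a b * (∑ e, w12 e c d) +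
      uA c d * (∑ e, wA e a b) + uB c d * (∑ e, wB e a b) := by
  rw [← sum_pattern_slot0 a b c d]
  have : ∀ e : Fin 5, (if Function.Injective ![e, a, b, c, d] then (1 : ℂ) else 0) =
      u01 e a * w01 b c d + u02 e b * w02 a c d + u12 a b * w12 e c d + uA c d * wA e a b + uB c d * wB e a b := by
    intro e
    rw [hsum]
    simp
  simp only [this, sum_add_distrib, sum_mul, mul_sum]

/-! ### §2 The linear-algebra core -/

/-- **Core.**  There are no `f, g : ℂ⁵`, matrices `u₁₂, u_A, u_B, C, D_A, D_B` and `3`-tensors `W₁, W₂` with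
`P₄,₅(a,b,c,d) = f(a) W₁(b,c,d) + g(b) W₂(a,c,d) + u₁₂(a,b) C(c,d) + u_A(c,d) D_A(a,b) + u_B(c,d) D_B(a,b)` for all letters:
the `{1,2}|{3,4}` flattening would send `{T : fᵀT = 0, Tg = 0}` (dimension `≥ 15`, `≥ 20` if `f = 0`) into
`span{C, u_A, u_B}`, while its kernel `{T : T + Tᵀ diagonal}` has dimension `≤ 15` and meets `{fᵀT = 0}` in dimension
`≤ 11` when `f ≠ 0`. -/
theorem core (f g : Fin 5 → ℂ) (W1 W2 : Fin 5 → Fin 5 → Fin 5 → ℂ) (u12 uA uB C DA DB : Fin 5 → Fin 5 → ℂ)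
    (hE : ∀ a b c d : Fin 5, (if (a ≠ b ∧ a ≠ c ∧ a ≠ d ∧ b ≠ c ∧ b ≠ d ∧ c ≠ d) then (1 : ℂ) else 0) =
      f a * W1 b c d + g b * W2 a c d + u12 a b * C c d + uA c d * DA a b + uB c d * DB a b) : False := by
  classical
  -- the pattern
  let P : Fin 5 → Fin 5 → Fin 5 → Fin 5 → ℂ := fun a b c d =>
    if (a ≠ b ∧ a ≠ c ∧ a ≠ d ∧ b ≠ c ∧ b ≠ d ∧ c ≠ d) then 1 else 0
  have hP : ∀ a b c d, P a b c d = f a * W1 b c d + g b * W2 a c d + u12 a b * C c d + uA c d * DA a b + uB c d * DB a b :=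
    hE
  -- the flattening `Φ`
  let Φ : (Fin 5 → Fin 5 → ℂ) →ₗ[ℂ] (Fin 5 → Fin 5 → ℂ) :=
    { toFun := fun T c d => ∑ a, ∑ b, T a b * P a b c d
      map_add' := by
        intro T T'; funext c d
        simp only [Pi.add_apply, add_mul, sum_add_distrib]
      map_smul' := by
        intro r T; funext c d
        simp only [Pi.smul_apply, smul_eq_mul, mul_assoc, mul_sum, RingHom.id_apply] }
  have hΦ : ∀ T c d, Φ T c d = ∑ a, ∑ b, T a b * P a b c d := fun T c d => rfl
  -- the functionals `T ↦ fᵀ T` and `T ↦ T g`, and `M = {fᵀ T = 0} ∩ {T g = 0}`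
  let ψ : (Fin 5 → Fin 5 → ℂ) →ₗ[ℂ] (Fin 5 → ℂ) :=
    { toFun := fun T b => ∑ a, f a * T a b
      map_add' := by intro T T'; funext b; simp only [Pi.add_apply, mul_add, sum_add_distrib]
      map_smul' := by
        intro r T; funext b; simp only [Pi.smul_apply, smul_eq_mul, mul_sum, RingHom.id_apply, mul_left_comm] }
  have hψ : ∀ T b, ψ T b = ∑ a, f a * T a b := fun T b => rfl
  let ψ' : (Fin 5 → Fin 5 → ℂ) →ₗ[ℂ] (Fin 5 → ℂ) :=
    { toFun := fun T a => ∑ b, T a b * g b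
      map_add' := by intro T T'; funext a; simp only [Pi.add_apply, add_mul, sum_add_distrib]
      map_smul' := by
        intro r T; funext a; simp only [Pi.smul_apply, smul_eq_mul, mul_sum, RingHom.id_apply, mul_assoc] }
  have hψ' : ∀ T a, ψ' T a = ∑ b, T a b * g b := fun T a => rfl
  let M : Submodule ℂ (Fin 5 → Fin 5 → ℂ) := LinearMap.ker ψ ⊓ LinearMap.ker ψ'
  have hM1 : ∀ T ∈ M, ∀ b, (∑ a, f a * T a b) = 0 := fun T hT b => by
    have := LinearMap.mem_ker.mp (Submodule.mem_inf.mp hT).1; exact congrFun this b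
  have hM2 : ∀ T ∈ M, ∀ a, (∑ b, T a b * g b) = 0 := fun T hT a => by
    have := LinearMap.mem_ker.mp (Submodule.mem_inf.mp hT).2; exact congrFun this a
  -- the target span
  let S : Submodule ℂ (Fin 5 → Fin 5 → ℂ) := Submodule.span ℂ ((({C, uA, uB} : Finset (Fin 5 → Fin 5 → ℂ)) : Set _))
  have hCS : C ∈ S := Submodule.subset_span (by simp)
  have hAS : uA ∈ S := Submodule.subset_span (by simp)
  have hBS : uB ∈ S := Submodule.subset_span (by simp)
  -- (1) `Φ` maps products `ξ ⊗ η` with `ξ ⊥ f`, `η ⊥ g` into `S`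
  have hprod : ∀ ξ η : Fin 5 → ℂ, (∑ a, f a * ξ a) = 0 → (∑ b, η b * g b) = 0 →
      Φ (fun a b => ξ a * η b) ∈ S := by
    intro ξ η hξ hη
    have key : Φ (fun a b => ξ a * η b) =
        (∑ a, ∑ b, ξ a * η b * u12 a b) • C + (∑ a, ∑ b, ξ a * η b * DA a b) • uA +
          (∑ a, ∑ b, ξ a * η b * DB a b) • uB := by
      funext c d
      simp only [hΦ, Pi.add_apply, Pi.smul_apply, smul_eq_mul, hP]
      have e1 : (∑ a, ∑ b, ξ a * η b * (f a * W1 b c d)) = (∑ a, f a * ξ a) * ∑ b, η b * W1 b c d := by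
        rw [sum_mul]; refine sum_congr rfl fun a _ => ?_; rw [mul_sum]; refine sum_congr rfl fun b _ => ?_; ring
      have e2 : (∑ a, ∑ b, ξ a * η b * (g b * W2 a c d)) = (∑ b, η b * g b) * ∑ a, ξ a * W2 a c d := by
        rw [sum_comm, sum_mul]; refine sum_congr rfl fun b _ => ?_; rw [mul_sum]; refine sum_congr rfl fun a _ => ?_; ring
      have e3 : ∀ X Y : Fin 5 → Fin 5 → ℂ, (∑ a, ∑ b, ξ a * η b * (X a b * Y c d)) = (∑ a, ∑ b, ξ a * η b * X a b) * Y c d := by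
        intro X Y; rw [sum_mul]; refine sum_congr rfl fun a _ => ?_; rw [sum_mul]; refine sum_congr rfl fun b _ => ?_; ring
      have e4 : ∀ X Y : Fin 5 → Fin 5 → ℂ, (∑ a, ∑ b, ξ a * η b * (Y c d * X a b)) = (∑ a, ∑ b, ξ a * η b * X a b) * Y c d := by
        intro X Y; rw [sum_mul]; refine sum_congr rfl fun a _ => ?_; rw [sum_mul]; refine sum_congr rfl fun b _ => ?_; ring
      simp only [mul_add, sum_add_distrib, e1, e2, e3, e4, hξ, hη, zero_mul, zero_add]
    rw [key]
    exact Submodule.add_mem _ (Submodule.add_mem _ (Submodule.smul_mem _ _ hCS) (Submodule.smul_mem _ _ hAS))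
      (Submodule.smul_mem _ _ hBS)
  -- (1') hence all of `M`, via the projections `ξ^{(a)} = δ_a − f_a c₀`, `η^{(b)} = δ_b − g_b d₀`
  have hMS : ∀ T ∈ M, Φ T ∈ S := by
    intro T hT
    have hT1 := hM1 T hT
    have hT2 := hM2 T hT
    obtain ⟨c0, hc0⟩ : ∃ c0 : Fin 5 → ℂ, f ≠ 0 → (∑ a, f a * c0 a) = 1 := by
      by_cases hf : f = 0
      · exact ⟨0, fun h => absurd hf h⟩
      · obtain ⟨i, hi⟩ : ∃ i, f i ≠ 0 := by
          by_contra hn; push Not at hn; exact hf (funext hn)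
        refine ⟨Pi.single i (f i)⁻¹, fun _ => ?_⟩
        rw [sum_eq_single i (fun b _ hb => by simp [hb]) (by simp)]
        simp [hi]
    obtain ⟨d0, hd0⟩ : ∃ d0 : Fin 5 → ℂ, g ≠ 0 → (∑ b, d0 b * g b) = 1 := by
      by_cases hg : g = 0
      · exact ⟨0, fun h => absurd hg h⟩
      · obtain ⟨i, hi⟩ : ∃ i, g i ≠ 0 := by
          by_contra hn; push Not at hn; exact hg (funext hn)
        refine ⟨Pi.single i (g i)⁻¹, fun _ => ?_⟩
        rw [sum_eq_single i (fun b _ hb => by simp [hb]) (by simp)]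
        simp [hi]
    have hfc : ∀ a, f a * (∑ x, f x * c0 x) = f a := by
      intro a
      by_cases hf : f = 0
      · simp [hf]
      · rw [hc0 hf, mul_one]
    have hgd : ∀ b, (∑ x, d0 x * g x) * g b = g b := by
      intro b
      by_cases hg : g = 0
      · simp [hg]
      · rw [hd0 hg, one_mul]
    let ξ : Fin 5 → Fin 5 → ℂ := fun a a' => (if a' = a then 1 else 0) - f a * c0 a'
    let η : Fin 5 → Fin 5 → ℂ := fun b b' => (if b' = b then 1 else 0) - g b * d0 b'
    have hξ : ∀ a, (∑ a', f a' * ξ a a') = 0 := by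
      intro a
      have : (∑ a', f a' * ξ a a') = f a - f a * ∑ x, f x * c0 x := by
        simp only [ξ, mul_sub, sum_sub_distrib, mul_ite, mul_one, mul_zero, sum_ite_eq', mem_univ, if_true, mul_sum]
        refine congrArg₂ _ rfl (sum_congr rfl fun x _ => ?_); ring
      rw [this, hfc, sub_self]
    have hη : ∀ b, (∑ b', η b b' * g b') = 0 := by
      intro b
      have : (∑ b', η b b' * g b') = g b - (∑ x, d0 x * g x) * g b := by
        simp only [η, sub_mul, sum_sub_distrib, ite_mul, one_mul, zero_mul, sum_ite_eq', mem_univ, if_true, sum_mul]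
        refine congrArg₂ _ rfl (sum_congr rfl fun x _ => ?_); ring
      rw [this, hgd, sub_self]
    -- `T = Σ_{a,b} T_{ab} ξ^{(a)} ⊗ η^{(b)}`
    have hpt : ∀ a' b', T a' b' = ∑ a, ∑ b, T a b * (ξ a a' * η b b') := by
      intro a' b'
      have e1 : ∀ a b, T a b * (ξ a a' * η b b') =
          (if a' = a then (if b' = b then T a b else 0) else 0) - (if a' = a then T a b * g b else 0) * d0 b'
            - c0 a' * (if b' = b then f a * T a b else 0) + c0 a' * d0 b' * (f a * (T a b * g b)) := by
        intro a b; simp only [ξ, η]; split_ifs <;> ring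
      have s1 : (∑ a, ∑ b, (if a' = a then (if b' = b then T a b else 0) else (0 : ℂ))) = T a' b' := by
        have inner : ∀ a, (∑ b, (if a' = a then (if b' = b then T a b else 0) else (0 : ℂ))) =
            if a' = a then T a b' else 0 := by
          intro a
          split_ifs with h
          · rw [Finset.sum_eq_single b' (fun b _ hb => if_neg (Ne.symm hb)) (by simp), if_pos rfl]
          · simp
        simp only [inner]
        rw [Finset.sum_eq_single a' (fun a _ ha => if_neg (Ne.symm ha)) (by simp), if_pos rfl]
      have s2 : (∑ a, ∑ b, (if a' = a then T a b * g b else 0) * d0 b') = (∑ b, T a' b * g b) * d0 b' := by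
        have inner : ∀ a, (∑ b, (if a' = a then T a b * g b else 0) * d0 b') =
            if a' = a then (∑ b, T a b * g b) * d0 b' else 0 := by
          intro a
          split_ifs with h
          · rw [sum_mul]
          · simp
        simp only [inner]
        rw [Finset.sum_eq_single a' (fun a _ ha => if_neg (Ne.symm ha)) (by simp), if_pos rfl]
      have s3 : (∑ a, ∑ b, c0 a' * (if b' = b then f a * T a b else 0)) = c0 a' * ∑ a, f a * T a b' := by
        have inner : ∀ a, (∑ b, c0 a' * (if b' = b then f a * T a b else 0)) = c0 a' * (f a * T a b') := by
          intro a
          rw [Finset.sum_eq_single b' (fun b _ hb => by rw [if_neg (Ne.symm hb), mul_zero]) (by simp), if_pos rfl]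
        simp only [inner, mul_sum]
      have s4 : (∑ a, ∑ b, c0 a' * d0 b' * (f a * (T a b * g b))) = c0 a' * d0 b' * ∑ a, f a * ∑ b, T a b * g b := by
        rw [mul_sum]; refine sum_congr rfl fun a _ => ?_; rw [mul_sum, mul_sum]
      simp only [e1, sum_add_distrib, sum_sub_distrib, s1, s2, s3, s4, hT1, hT2, mul_zero, zero_mul, sum_const_zero,
        sub_zero, add_zero]
    have hTdec : T = ∑ a, ∑ b, T a b • (fun a' b' => ξ a a' * η b b') := by
      funext a' b'
      rw [Finset.sum_apply, Finset.sum_apply, hpt a' b']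
      refine sum_congr rfl fun a _ => ?_
      rw [Finset.sum_apply, Finset.sum_apply]
      refine sum_congr rfl fun b _ => ?_
      simp only [Pi.smul_apply, smul_eq_mul]
    rw [hTdec, map_sum]
    refine Submodule.sum_mem _ fun a _ => ?_
    rw [map_sum]
    refine Submodule.sum_mem _ fun b _ => ?_
    rw [map_smul]
    exact Submodule.smul_mem _ _ (hprod (ξ a) (η b) (hξ a) (hη b))
  -- (2) the kernel of `Φ` lies in `K₀ = {T : T_{ab} + T_{ba} = 0, a ≠ b}`
  let K0 : Submodule ℂ (Fin 5 → Fin 5 → ℂ) :=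
    { carrier := {T | ∀ a b : Fin 5, a ≠ b → T a b + T b a = 0}
      add_mem' := by
        intro T T' hT hT' a b hab
        simp only [Pi.add_apply]
        linear_combination hT a b hab + hT' a b hab
      zero_mem' := by intro a b _; simp
      smul_mem' := by
        intro r T hT a b hab
        simp only [Pi.smul_apply, smul_eq_mul]
        linear_combination r * hT a b hab }
  have hK0mem : ∀ T : Fin 5 → Fin 5 → ℂ, T ∈ K0 ↔ ∀ a b : Fin 5, a ≠ b → T a b + T b a = 0 := fun T => Iff.rfl
  have hkerK0 : LinearMap.ker Φ ≤ K0 := by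
    intro T hT
    rw [hK0mem]
    have h0 : ∀ c d, Φ T c d = 0 := fun c d => by
      have := LinearMap.mem_ker.mp hT; exact congrFun (congrFun this c) d
    exact flattening_kernel T (fun c d => by rw [← hΦ]; exact h0 c d)
  -- (3) `finrank K₀ ≤ 15`: an element of `K₀` is determined by its upper triangle
  have hK0 : finrank ℂ K0 ≤ 15 := by
    let π : (Fin 5 → Fin 5 → ℂ) →ₗ[ℂ] ({p : Fin 5 × Fin 5 // p.1 ≤ p.2} → ℂ) :=
      { toFun := fun T p => T p.1.1 p.1.2
        map_add' := by intro T T'; funext p; rfl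
        map_smul' := by intro r T; funext p; rfl }
    have hinj : Function.Injective (π.domRestrict K0) := by
      intro T T' hTT'
      apply Subtype.ext
      funext a b
      have hpt : ∀ p : {p : Fin 5 × Fin 5 // p.1 ≤ p.2},
          (T : Fin 5 → Fin 5 → ℂ) p.1.1 p.1.2 = (T' : Fin 5 → Fin 5 → ℂ) p.1.1 p.1.2 := fun p => congrFun hTT' p
      rcases le_or_gt a b with hab | hab
      · exact hpt ⟨(a, b), hab⟩
      · have hba : b ≠ a := Fin.ne_of_lt hab
        have e1 := (hK0mem _).mp T.2 b a hba
        have e2 := (hK0mem _).mp T'.2 b a hba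
        have e3 := hpt ⟨(b, a), le_of_lt hab⟩
        simp only at e3
        linear_combination e1 - e2 - e3
    have h1 := LinearMap.finrank_le_finrank_of_injective hinj
    have h2 : finrank ℂ ({p : Fin 5 × Fin 5 // p.1 ≤ p.2} → ℂ) = 15 := by
      rw [finrank_fintype_fun_eq_card]; rfl
    omega
  -- (4) when `f ≠ 0`: `finrank (K₀ ⊓ ker ψ) ≤ 11`
  have h11 : f ≠ 0 → finrank ℂ ↥(K0 ⊓ LinearMap.ker ψ) ≤ 11 := by
    intro hf
    obtain ⟨i, hi⟩ : ∃ i, f i ≠ 0 := by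
      by_contra hn; push Not at hn; exact hf (funext hn)
    let c0 : Fin 5 → ℂ := Pi.single i (f i)⁻¹
    have hc0 : (∑ a, f a * c0 a) = 1 := by
      rw [sum_eq_single i (fun b _ hb => by simp [c0, hb]) (by simp)]
      simp [c0, hi]
    -- the functional `z ↦ f ⬝ z` and its kernel `f^⊥`
    let fl : (Fin 5 → ℂ) →ₗ[ℂ] ℂ :=
      { toFun := fun z => ∑ a, f a * z a
        map_add' := by intro z z'; simp only [Pi.add_apply, mul_add, sum_add_distrib]
        map_smul' := by intro r z; simp only [Pi.smul_apply, smul_eq_mul, mul_sum, RingHom.id_apply, mul_left_comm] }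
    have hfl : ∀ z, fl z = ∑ a, f a * z a := fun z => rfl
    -- the range of `ψ` on `K₀` contains `f^⊥ = ker fl`
    have hfperp : LinearMap.ker fl ≤ K0.map ψ := by
      intro z hz
      have hz0 : (∑ a, f a * z a) = 0 := by rw [← hfl]; exact LinearMap.mem_ker.mp hz
      -- `Λ = c₀ ⊗ z − z ⊗ c₀` is antisymmetric and `ψ Λ = z`
      refine ⟨fun a b => c0 a * z b - z a * c0 b, ?_, ?_⟩
      · rw [SetLike.mem_coe, hK0mem]
        intro a b _
        ring
      · funext b
        rw [hψ]
        simp only [mul_sub, sum_sub_distrib]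
        have e1 : (∑ a, f a * (c0 a * z b)) = (∑ a, f a * c0 a) * z b := by
          rw [sum_mul]; refine sum_congr rfl fun a _ => ?_; ring
        have e2 : (∑ a, f a * (z a * c0 b)) = (∑ a, f a * z a) * c0 b := by
          rw [sum_mul]; refine sum_congr rfl fun a _ => ?_; ring
        rw [e1, e2, hc0, hz0]; ring
    have hfperp4 : 4 ≤ finrank ℂ (LinearMap.ker fl) := by
      have hr := LinearMap.finrank_range_add_finrank_ker fl
      have h5 : finrank ℂ (Fin 5 → ℂ) = 5 := by rw [finrank_fintype_fun_eq_card]; rfl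
      have h1 : finrank ℂ (LinearMap.range fl) ≤ 1 := by
        calc _ ≤ finrank ℂ ℂ := Submodule.finrank_le _
          _ = 1 := finrank_self ℂ
      omega
    have hrn := LinearMap.finrank_range_add_finrank_ker (ψ.domRestrict K0)
    rw [LinearMap.range_domRestrict, LinearMap.ker_domRestrict] at hrn
    have hrange : 4 ≤ finrank ℂ (K0.map ψ) := hfperp4.trans (Submodule.finrank_mono hfperp)
    have hker : finrank ℂ ↥(K0 ⊓ LinearMap.ker ψ) ≤ finrank ℂ ((LinearMap.ker ψ).comap K0.subtype) := by
      rw [← Submodule.map_comap_subtype]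
      exact Submodule.finrank_map_le _ _
    omega
  -- (5) `finrank S ≤ 3`
  have hS : finrank ℂ S ≤ 3 :=
    (finrank_span_finset_le_card _).trans Finset.card_le_three
  -- (6) rank–nullity for `Φ` restricted to `M`
  have hrnΦ := LinearMap.finrank_range_add_finrank_ker (Φ.domRestrict M)
  rw [LinearMap.range_domRestrict, LinearMap.ker_domRestrict] at hrnΦ
  have hmap : finrank ℂ (M.map Φ) ≤ 3 := by
    refine le_trans (Submodule.finrank_mono ?_) hS
    rintro _ ⟨T, hT, rfl⟩
    exact hMS T hT
  have hcomap : finrank ℂ ((LinearMap.ker Φ).comap M.subtype) = finrank ℂ ↥(M ⊓ LinearMap.ker Φ) := by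
    rw [← Submodule.map_comap_subtype]
    exact LinearEquiv.finrank_eq (Submodule.equivMapOfInjective _ (Submodule.injective_subtype M) _)
  have hkerΦ : finrank ℂ ↥(M ⊓ LinearMap.ker Φ) ≤ finrank ℂ ↥(K0 ⊓ LinearMap.ker ψ) :=
    Submodule.finrank_mono (le_inf (inf_le_right.trans hkerK0) (inf_le_left.trans inf_le_left))
  have hkerΦ' : finrank ℂ ↥(M ⊓ LinearMap.ker Φ) ≤ finrank ℂ K0 :=
    Submodule.finrank_mono (inf_le_right.trans hkerK0)
  -- (7) dimension of `M`
  have h25 : finrank ℂ (Fin 5 → Fin 5 → ℂ) = 25 := by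
    rw [finrank_pi_fintype]; simp [finrank_fintype_fun_eq_card]
  have h5 : ∀ φ : (Fin 5 → Fin 5 → ℂ) →ₗ[ℂ] (Fin 5 → ℂ), finrank ℂ (LinearMap.range φ) ≤ 5 := fun φ =>
    calc _ ≤ finrank ℂ (Fin 5 → ℂ) := Submodule.finrank_le _
      _ = 5 := by rw [finrank_fintype_fun_eq_card]; rfl
  have hker' : 20 ≤ finrank ℂ (LinearMap.ker ψ') := by
    have := LinearMap.finrank_range_add_finrank_ker ψ'; have := h5 ψ'; omega
  by_cases hf : f = 0
  · -- `f = 0`: `M = ker ψ'` has dimension `≥ 20`, but `finrank M ≤ 3 + finrank K₀ ≤ 18`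
    have hMeq : LinearMap.ker ψ' ≤ M := by
      intro T hT
      refine Submodule.mem_inf.mpr ⟨?_, hT⟩
      rw [LinearMap.mem_ker]
      funext b
      rw [hψ]
      simp [hf]
    have := Submodule.finrank_mono hMeq
    omega
  · -- `f ≠ 0`: `finrank M ≥ 15` (rank–nullity for `ψ` on `ker ψ'`), but `finrank M ≤ 3 + 11`
    have h15 : 15 ≤ finrank ℂ M := by
      have hrn := LinearMap.finrank_range_add_finrank_ker (ψ.domRestrict (LinearMap.ker ψ'))
      rw [LinearMap.range_domRestrict, LinearMap.ker_domRestrict] at hrn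
      have e1 : finrank ℂ ((LinearMap.ker ψ').map ψ) ≤ 5 :=
        (Submodule.finrank_mono LinearMap.map_le_range).trans (h5 ψ)
      have e2 : finrank ℂ ((LinearMap.ker ψ).comap (LinearMap.ker ψ').subtype) =
          finrank ℂ ↥(LinearMap.ker ψ ⊓ LinearMap.ker ψ') := by
        rw [inf_comm, ← Submodule.map_comap_subtype (LinearMap.ker ψ') (LinearMap.ker ψ)]
        exact LinearEquiv.finrank_eq (Submodule.equivMapOfInjective _ (Submodule.injective_subtype _) _)
      have e3 : finrank ℂ M = finrank ℂ ↥(LinearMap.ker ψ ⊓ LinearMap.ker ψ') := rfl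
      omega
    have := h11 hf
    omega

/-! ### §3 The profile `K₃ ⊔ 2K₂` -/

/-- **The pair profile «triangle `{01,02,12}` + double edge `{34,34}`» does not decompose `P₅`.** [folklore] -/
theorem triangle_digon (u01 u02 u12 uA uB : Fin 5 → Fin 5 → ℂ) (w01 w02 w12 wA wB : Fin 5 → Fin 5 → Fin 5 → ℂ) :
    ¬ ∀ v : Fin 5 → Fin 5, (if Function.Injective v then (1 : ℂ) else 0) =
      u01 (v 0) (v 1) * w01 (v 2) (v 3) (v 4) + u02 (v 0) (v 2) * w02 (v 1) (v 3) (v 4) +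
      u12 (v 1) (v 2) * w12 (v 0) (v 3) (v 4) + uA (v 3) (v 4) * wA (v 0) (v 1) (v 2) +
      uB (v 3) (v 4) * wB (v 0) (v 1) (v 2) := by
  intro hsum
  exact core (fun a => ∑ e, u01 e a) (fun b => ∑ e, u02 e b) w01 (fun a c d => w02 a c d) u12 uA uB
    (fun c d => ∑ e, w12 e c d) (fun a b => ∑ e, wA e a b) (fun a b => ∑ e, wB e a b)
    (fun a b c d => by rw [contract_slot0 u01 u02 u12 uA uB w01 w02 w12 wA wB hsum a b c d])

end LaplaceFivePairCore

end Summit.ValiantsHypothesis.ValiantsHypothesis.Theorems.RigidityForcesSymmetryRankRigidMinimalRepr
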